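import Summits.BirchSwinnertonDyer.BirchSwinnertonDyer.Theses.ByReductionTypeAtTwo
import Summits.BirchSwinnertonDyer.BirchSwinnertonDyer.Theorems.ByReductionTypeAtTwoAdditiveOverK
import HarnessLib

/-!
# Line `add-twist-overK` — skeleton for crux `AdditiveRankZeroAtTwo`
# (item stmt-BirchSwinnertonDyer-19098, route ByReductionTypeAtTwo, rung K4, rank 5; seat `bsd-2adic-addL2`)

The crux (BSD₂ for every non-CM `E/ℚ` of analytic rank `0` with ADDITIVE reduction at `2`; 1 945 book230
residue classes = quadratic sub-class 563 · odd core 601 · 2-power core 781) from FOUR stubs, composed by the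
LANDED bridges of the seat's GEN 4 (`Theorems/ByReductionTypeAtTwoAdditive{Inputs,TwistSupply,OverK}.lean`,
p421450 / p421844 / p422893; MEMO-4 @48e367a2887928fa §7 variant A′, referee RC-30 PASS). Planner
bsd-2adic-plan GEN 13, `plan/routes/NEXT-ROUND.md` @7b7bc133c6e65d4e, CONE NOTE: the ADD decomposition (K-3)
lives as THIS LINE under 19098 (an item split would push K4's `closes` past the BC1 cone), its children being
the stubs below; `AddDefectThreeAtTwo` = the named wall stub.

* `stub_addPub` — PUBLISHED: Gross–Zagier–Kolyvagin (`rank_eq_analyticRank_of_analyticRank_le_one`) ∧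
  modularity (`hasEntireLFunction_rat`) ∧ Milne 1972 Thm. 1 in Dokchitser–Dokchitser's any-model currency
  (`Milne1972.bsdQuotient_baseChange_quadratic_anyModel`) ∧ Hoffstein–Luo 1997 (`HoffsteinLuo1997_exists_twist_L_one_ne_zero`);
  never provable in-tree, closed by citation (the first two are the route's PUB items 19149 / 19921 by name).
* `stub_twistBSD` — SIBLING: BSD₂ for every non-CM analytic-rank-`0` curve SEMISTABLE at `2`
  (good ordinary ∨ good supersingular ∨ multiplicative) = the conjunction of the route's OWN three rank-`0` cruxes
  `GoodOrdinaryRankZeroAtTwo` (19095) / `SupersingularRankZeroAtTwo` (19097) / `MultiplicativeRankZeroAtTwo`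
  (19096) restricted to the twist habitat — ONE LINE from them (`twistBSD_of_siblings` below,
  `Theorems.bsdp_two_twist_of_siblings`). NEVER worked inside this line: it closes when the siblings close.
* `stub_addQuadraticOverK` — HARDEST (the line's research object, = planner child `AddQuadraticOverKAtTwo`):
  for every non-CM `r_an = 0` curve additive at `2` and every quadratic `K` whose local character at `2`
  semistabilises it with `L(E^{(d_K)},1) ≠ 0` (a Hoffstein–Luo field; `K` is then ramified at `2`), the `2`-part
  of BSD over `K` for `E_K` on the CANONICAL model, `AdditivePotMult.MissingPPartOverCAt (W.baseChange K) 2` —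
  563 classes. HONEST LABEL (MEMO-4 §4, kernel `Theorems.forall_overKC_iff_additiveQuadraticAtTwo_of_hoffsteinLuo`):
  granted `stub_addPub` + `stub_twistBSD` it is EQUIVALENT to the quadratic part of the crux — a RELOCATION into
  a semistable-over-`K` setting, not a weakening; its strictly smaller content is the `K`-road (I-K)+(II-K)^C
  (`Theorems.addQuadraticOverKC_of_cycRoadC`, p425179: glues into THIS stub with modularity only), produced per
  class on the MEMO-3 habitat by the twist pinch (first instance rung 274032m1, p425655). Print at `p = 2` over
  any `K ≠ ℚ`: none (Kato Conj. 12.10 excludes `2 ∈ 𝔭`; Kriz–Li 2019 needs `2` split; Delbourgo 1998 `p` odd).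
* `stub_addDefectThree` — WALL / residual-grade (= planner child `AddDefectThreeAtTwo`): the defect-`≥ 3`
  sub-class (1 382 classes: odd core `C₃/C₆` 601 + 2-power core `Q₈/SL₂(𝔽₃)/C₄` 781) at output level
  `Typed.MissingPPartAt W 2`. Odd core: MEMO-1's inert pair door `Theorems.additiveDefectAtTwo_of_inertPair`
  with three far-side ∀-inputs none of which is in print ((b₅) FH general form; lens-L1 upper halves at an
  additive `2`; G-odd over a cyclic cubic); 2-power core: no descent group of order prime to `2`, `π₂(f_E)`
  supercuspidal — MATH-BOUND (planner: declared residual, exempt T3/T4).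

Census (MEMO-1 §1, kit j239581): 1 945 = 1 940 r0 + 5 r1; quadratic 563 = `C₂` 100 + pot-mult 463 (inertial
class `d* ∈ {−1, ±2}` on 563/563); per-class accounting (MEMO-3 ADDENDUM-2): door-ready 2 (274032m ← 17127d1,
265200dr ← 16575g1) + 8 modulo the non-split twist's `λ`-part; 122 pot-ordinary quadratic classes uncomputed.
-/

set_option autoImplicit false
-- the Cruxes namespace of this sub repeats the summit name by design (D-0017 nested layout)
set_option linter.dupNamespace false

open WeierstrassCurve Literature.NumberTheory.EllipticCurves
  Literature.NumberTheory.EllipticCurves.Rank1Residual Literature.NumberTheory.EllipticCurves.Rank1Residual.Typed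
  Summit.BirchSwinnertonDyer.Rank1Residual.AdditivePotMult
  Summit.BirchSwinnertonDyer.Rank1Residual.X5.AddTwoL2
  Summit.BirchSwinnertonDyer.BirchSwinnertonDyer.Theses.ByReductionTypeAtTwo

namespace Summit.BirchSwinnertonDyer.BirchSwinnertonDyer.Cruxes.AdditiveRankZeroAtTwo

namespace AddTwistOverK

/-- stub (1): the four PUBLISHED inputs — GZK ∧ modularity ∧ Milne any-model ∧ Hoffstein–Luo (closed by citation). -/
theorem stub_addPub :
    rank_eq_analyticRank_of_analyticRank_le_one ∧ hasEntireLFunction_rat ∧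
      Milne1972.bsdQuotient_baseChange_quadratic_anyModel ∧ HoffsteinLuo1997_exists_twist_L_one_ne_zero := by
  sorry

/-- stub (2): SIBLING — BSD₂ for non-CM analytic-rank-`0` curves SEMISTABLE at `2` (= the route's three rank-`0`
cruxes 19095 / 19097 / 19096 on the twist habitat; one line from them, `twistBSD_of_siblings`). -/
theorem stub_twistBSD :
    ∀ (Wd : WeierstrassCurve ℚ) [Wd.IsElliptic] [Wd.IsGloballyMinimal], ¬ Wd.HasCM → Wd.analyticRank = 0 →
      (GoodOrd Wd 2 ∨ GoodSS Wd 2 ∨ Mult Wd 2) → BSDp Wd 2 := by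
  sorry

/-- stub (3): HARDEST — the `2`-part of BSD over a Hoffstein–Luo quadratic field `K` for `E_K` on the canonical
model, for every non-CM `r_an = 0` curve additive at `2` (563 classes; relocation-grade, see the module docstring). -/
theorem stub_addQuadraticOverK :
    ∀ (W : WeierstrassCurve ℚ) [W.IsElliptic] [W.IsGloballyMinimal], ¬ W.HasCM → W.analyticRank = 0 →
      Addv W 2 → ∀ (K : Type) [Field K] [NumberField K], Module.finrank ℚ K = 2 →
        SemistableTwistAtTwo W K → (W.quadraticTwist (NumberField.discr K : ℚ)).entireLFunction 1 ≠ 0 →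
          MissingPPartOverCAt (W.baseChange K) 2 := by
  sorry

/-- stub (4): WALL — the defect-`≥ 3` sub-class at output level (1 382 classes; residual-grade, MATH-BOUND). -/
theorem stub_addDefectThree :
    ∀ (W : WeierstrassCurve ℚ) [W.IsElliptic] [W.IsGloballyMinimal], ¬ W.HasCM → W.analyticRank = 0 →
      DefectAtLeastThree W → MissingPPartAt W 2 := by
  sorry

/-- The SIBLING stub from the route's three rank-`0` cruxes BY NAME (one line, `Theorems.bsdp_two_twist_of_siblings`,
p421450): closing 19095 + 19096 + 19097 closes `stub_twistBSD`. [cite: CremonaAlgorithms1997, Table 1 (shape only)] -/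
theorem twistBSD_of_siblings (hOrd : GoodOrdinaryRankZeroAtTwo) (hMult : MultiplicativeRankZeroAtTwo)
    (hSS : SupersingularRankZeroAtTwo) :
    ∀ (Wd : WeierstrassCurve ℚ) [Wd.IsElliptic] [Wd.IsGloballyMinimal], ¬ Wd.HasCM → Wd.analyticRank = 0 →
      (GoodOrd Wd 2 ∨ GoodSS Wd 2 ∨ Mult Wd 2) → BSDp Wd 2 :=
  fun Wd _ _ hcm hr hred => Theorems.bsdp_two_twist_of_siblings hOrd hMult hSS Wd hcm hr hred

/-- composition = THE SKELETON: the crux BY NAME from exactly the four registered stubs — quadratic sub-class: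
Hoffstein–Luo field (`Theorems.existsSemistabilisingNonvanishingTwist_of_hoffsteinLuo`, p421844) ↦ minimal model
of the semistable twist (`Theorems.exists_minimalTwist_semistable_rankZero`) ↦ `stub_twistBSD` ↦ model-free Milne
descent (`AdditivePotMult.bsdp_of_pPartOverC_baseChange`) fed by `stub_addQuadraticOverK`; defect ≥ 3:
`stub_addDefectThree` ↦ `Typed.bsdp_of_missingPPartAt`; glued by `Theorems.additiveRankZeroAtTwo_of_quadratic_of_defect`
(exact sub-partition). Kernel-checked, no sorry of its own (= MEMO-4 Sketch-ADD variant A′). -/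
theorem AdditiveRankZeroAtTwo_of :
    Summit.BirchSwinnertonDyer.BirchSwinnertonDyer.Theses.ByReductionTypeAtTwo.AdditiveRankZeroAtTwo := by
  obtain ⟨hGZK, hmod, hMilneC, hHL⟩ := stub_addPub
  haveI : Fact (Nat.Prime 2) := ⟨Nat.prime_two⟩
  refine Theorems.additiveRankZeroAtTwo_of_quadratic_of_defect ?_ ?_
  · intro W _ _ hcm hr hadd hq
    obtain ⟨K, _, _, h2, hst, hL⟩ :=
      Theorems.existsSemistabilisingNonvanishingTwist_of_hoffsteinLuo hHL W hq
    obtain ⟨Wd, _, _, hWd, hcmd, hrd, hred⟩ :=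
      Theorems.exists_minimalTwist_semistable_rankZero W hcm K hst hL
    exact bsdp_of_pPartOverC_baseChange W 2 K Wd hGZK hmod hMilneC (by omega) h2 hWd (by omega)
      (stub_addQuadraticOverK W hcm hr hadd K h2 hst hL) (stub_twistBSD Wd hcmd hrd hred)
  · intro W _ _ hcm hr hdef
    exact bsdp_of_missingPPartAt W 2 hGZK (by omega) (stub_addDefectThree W hcm hr hdef)

end AddTwistOverK

end Summit.BirchSwinnertonDyer.BirchSwinnertonDyer.Cruxes.AdditiveRankZeroAtTwo
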